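import Mathlib.RepresentationTheory.Homological.GroupCohomology.Functoriality
import Mathlib.LinearAlgebra.Projection
import Literature.AlgebraicGeometry.HodgeTheory.LocallyTrivialExtensionClasses

/-!
# Route LinearSystemTorelli — crux `LocalTubeSpan` (stmt-HodgeConjecture-2490): cyclic detection across a stable direct-sum decomposition

Helper file (`--supports stmt-HodgeConjecture-2490`, line `Sketch` of the crux chain, cycle 4
"portability of cyclic detection", stub `stub_directSum`).  The line reduces the crux ("local
Schnell theorem", C. Schnell, *Primitive cohomology and the tube mapping*, Math. Z. 268 (2010) §3,
§7) to CYCLIC DETECTION: injectivity of Schnell's third map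
`evalCoinv A : H¹(G, A) → ∏_{g ∈ G} A/(g - 1)A`, i.e. every *undetected* `1`-cocycle `φ`
(`φ g ∈ (g - 1)A` for all `g`) is a coboundary.  Cycle 4 makes cyclic detection portable; this
file moves it across a decomposition `A = W₁ ⊕ W₂` into two `G`-stable summands (in the route:
`H^{2p-1}(X_s) = H^{2p-1}(X_s)_van ⊕ i^*H^{2p-1}(X)`):

* `localTubeSpan_injective_evalCoinv_iff_of_isCompl` — for `G`-stable submodules `W₁, W₂ ≤ A`
  with `IsCompl W₁ W₂`, the third map of `A` is injective iff the third maps of the two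
  subrepresentations `W₁`, `W₂` (Mathlib's `Representation.subrepresentation`) are.

Mathematically `H¹(G, W₁ ⊕ W₂) = H¹(G, W₁) ⊕ H¹(G, W₂)` and
`(g - 1)(W₁ ⊕ W₂) = (g - 1)W₁ ⊕ (g - 1)W₂`.  Proof, at the level of cocycles
(`localTubeSpan_injective_evalCoinv_iff_forall_cocycles₁`): the projections
`p₁ : A → W₁`, `p₂ : A → W₂` along the complements (`Submodule.projectionOnto`) are
`G`-equivariant because both summands are stable (`localTubeSpan_projectionOnto_apply_rho`).
(⇒) An undetected cocycle `φ₁` of `W₁` is an undetected cocycle `g ↦ ↑(φ₁ g)` of `A`, hence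
`↑(φ₁ g) = g·x - x`; projecting, `φ₁ g = p₁ (g·x - x) = g·(p₁ x) - p₁ x` is a coboundary (a
stable summand is an equivariant retract).  (⇐) For an undetected cocycle `φ` of `A` the
projections `pᵢ ∘ φ` are undetected cocycles of `Wᵢ`, hence `pᵢ (φ g) = g·xᵢ - xᵢ`, and
`φ g = ↑(p₁ (φ g)) + ↑(p₂ (φ g)) = g·(x₁ + x₂) - (x₁ + x₂)`.  Pure group cohomology over Mathlib
(`groupCohomology.H1`, `cocycles₁`, `H1π_eq_zero_iff`) and the tree's vocabulary
(`Literature.AlgebraicGeometry.HodgeTheory.LocallyTrivialExtensionClasses`: `evalCoinv`,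
`subOneRange`, `evalCoinv_H1π`, `mem_coboundaries₁_iff_exists`); any commutative coefficient ring,
any group; no named facts, no geometry.
-/

-- `Summit.HodgeConjecture.HodgeConjecture.Theorems` is the mandated namespace (single-conjunct summit:
-- Sub = Summit), which `linter.dupNamespace` flags on every declaration; the lakefile turns the
-- linter off tree-wide (weak option), restated here so stand-alone elaboration is warning-free too.
set_option linter.dupNamespace false

noncomputable section

open CategoryTheory groupCohomology
open Literature.AlgebraicGeometry.HodgeTheory

namespace Summit.HodgeConjecture.HodgeConjecture.Theorems

universe u

/-! ### Cyclic detection at the level of cocycles -/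

/-- **Cyclic detection on cocycles.**  Schnell's third map `H¹(G, A) → ∏_g A/(g - 1)A` is
injective iff every undetected `1`-cocycle `φ` (`φ g ∈ (g - 1)A` for all `g`) is a coboundary,
`φ g = g·x - x` for one `x ∈ A`. [folklore] -/
theorem localTubeSpan_injective_evalCoinv_iff_forall_cocycles₁ {k G : Type u} [Group G]
    [CommRing k] (A : Rep k G) :
    Function.Injective (evalCoinv A) ↔
      ∀ φ : cocycles₁ A, (∀ g : G, (φ : G → A.V) g ∈ subOneRange A g) →
        ∃ x : A.V, ∀ g : G, A.ρ g x - x = φ g := by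
  constructor
  · intro hinj φ hφ
    have h0 : evalCoinv A (H1π A φ) = 0 := by
      funext g
      rw [evalCoinv_H1π, Pi.zero_apply, Submodule.mkQ_apply, Submodule.Quotient.mk_eq_zero]
      exact hφ g
    have hzero : H1π A φ = 0 := (injective_iff_map_eq_zero _).1 hinj _ h0
    rwa [H1π_eq_zero_iff, mem_coboundaries₁_iff_exists] at hzero
  · intro h
    refine (injective_iff_map_eq_zero _).2 fun ξ hξ => ?_
    induction ξ using H1_induction_on with
    | h φ =>
      rw [H1π_eq_zero_iff, mem_coboundaries₁_iff_exists]
      refine h φ fun g => ?_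
      have := congr_fun hξ g
      rwa [evalCoinv_H1π, Pi.zero_apply, Submodule.mkQ_apply, Submodule.Quotient.mk_eq_zero]
        at this

/-! ### The equivariant projections of a stable decomposition `A = W₁ ⊕ W₂` -/

/-- For complementary `G`-stable submodules `W₁, W₂ ≤ A`, the projection `A → W₁` along `W₂`
is `G`-equivariant: `p₁ (g·x) = g·(p₁ x)` (decompose `x = w₁ + w₂`; `g·w₁ ∈ W₁`, `g·w₂ ∈ W₂`).
[folklore] -/
theorem localTubeSpan_projectionOnto_apply_rho {k G : Type u} [Group G] [CommRing k]
    (A : Rep k G) (W₁ W₂ : Submodule k A.V)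
    (h₁ : ∀ g : G, W₁ ≤ W₁.comap (A.ρ g)) (h₂ : ∀ g : G, W₂ ≤ W₂.comap (A.ρ g))
    (hc : IsCompl W₁ W₂) (g : G) (x : A.V) :
    W₁.projectionOnto W₂ hc (A.ρ g x) =
      A.ρ.subrepresentation W₁ h₁ g (W₁.projectionOnto W₂ hc x) := by
  have hw₁ : A.ρ g (W₁.projectionOnto W₂ hc x : A.V) ∈ W₁ := h₁ g (W₁.projectionOnto W₂ hc x).2
  have hw₂ : A.ρ g (W₂.projectionOnto W₁ hc.symm x : A.V) ∈ W₂ :=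
    h₂ g (W₂.projectionOnto W₁ hc.symm x).2
  conv_lhs => rw [← Submodule.projection_add_projection_eq_self hc x]
  rw [map_add, map_add, Submodule.projection_apply, Submodule.projection_apply,
    Submodule.projectionOnto_apply_of_mem_left hc hw₁,
    Submodule.projectionOnto_apply_of_mem_right hc hw₂, add_zero]
  rfl

/-- The projection to a stable summand of a `1`-cocycle of `A` is a `1`-cocycle of the summand.
[folklore] -/
theorem localTubeSpan_projectionOnto_comp_mem_cocycles₁ {k G : Type u} [Group G] [CommRing k]
    (A : Rep k G) (W₁ W₂ : Submodule k A.V)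
    (h₁ : ∀ g : G, W₁ ≤ W₁.comap (A.ρ g)) (h₂ : ∀ g : G, W₂ ≤ W₂.comap (A.ρ g))
    (hc : IsCompl W₁ W₂) (φ : cocycles₁ A) :
    (fun g : G => W₁.projectionOnto W₂ hc (φ g)) ∈
      cocycles₁ (Rep.of (A.ρ.subrepresentation W₁ h₁)) := by
  rw [mem_cocycles₁_iff]
  intro g h
  dsimp only
  rw [(mem_cocycles₁_iff φ).1 φ.2 g h, map_add,
    localTubeSpan_projectionOnto_apply_rho A W₁ W₂ h₁ h₂ hc]

/-- The projection to a stable summand of an undetected `1`-cocycle of `A` is undetected: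
`p₁ ((g - 1)A) ⊆ (g - 1)W₁`. [folklore] -/
theorem localTubeSpan_projectionOnto_apply_mem_subOneRange {k G : Type u} [Group G] [CommRing k]
    (A : Rep k G) (W₁ W₂ : Submodule k A.V)
    (h₁ : ∀ g : G, W₁ ≤ W₁.comap (A.ρ g)) (h₂ : ∀ g : G, W₂ ≤ W₂.comap (A.ρ g))
    (hc : IsCompl W₁ W₂) (φ : cocycles₁ A) (hφ : ∀ g : G, (φ : G → A.V) g ∈ subOneRange A g)
    (g : G) :
    W₁.projectionOnto W₂ hc (φ g) ∈ subOneRange (Rep.of (A.ρ.subrepresentation W₁ h₁)) g := by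
  obtain ⟨y, hy⟩ := hφ g
  refine ⟨W₁.projectionOnto W₂ hc y, ?_⟩
  rw [LinearMap.sub_apply, LinearMap.id_apply] at hy ⊢
  rw [← hy, map_sub, localTubeSpan_projectionOnto_apply_rho A W₁ W₂ h₁ h₂ hc]

/-! ### Cyclic detection across the decomposition -/

/-- **A stable summand inherits cyclic detection.**  If `W₁` has a `G`-stable complement `W₂`
in `A` and Schnell's third map of `A` is injective, then so is the third map of the
subrepresentation `W₁`: an undetected cocycle `φ₁` of `W₁` is an undetected cocycle
`g ↦ ↑(φ₁ g) = g·x - x` of `A`, and `φ₁ g = p₁ (g·x - x) = g·(p₁ x) - p₁ x` by equivariance of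
the projection `p₁ : A → W₁` along `W₂`. [folklore] -/
theorem localTubeSpan_injective_evalCoinv_subrepresentation_of_isCompl {k G : Type u} [Group G]
    [CommRing k] (A : Rep k G) (W₁ W₂ : Submodule k A.V)
    (h₁ : ∀ g : G, W₁ ≤ W₁.comap (A.ρ g)) (h₂ : ∀ g : G, W₂ ≤ W₂.comap (A.ρ g))
    (hc : IsCompl W₁ W₂) (hinj : Function.Injective (evalCoinv A)) :
    Function.Injective (evalCoinv (Rep.of (A.ρ.subrepresentation W₁ h₁))) := by
  rw [localTubeSpan_injective_evalCoinv_iff_forall_cocycles₁] at hinj ⊢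
  intro φ hφ
  -- the cochain `g ↦ ↑(φ g)` is a `1`-cocycle of `A`
  have hψmem : (fun g : G => ((φ g : W₁) : A.V)) ∈ cocycles₁ A := by
    rw [mem_cocycles₁_iff]
    intro g h
    dsimp only
    rw [(mem_cocycles₁_iff φ).1 φ.2 g h, Submodule.coe_add]
    rfl
  -- and it is undetected
  have hψ : ∀ g : G, ((φ g : W₁) : A.V) ∈ subOneRange A g := fun g => by
    obtain ⟨y, hy⟩ := hφ g
    refine ⟨(y : A.V), ?_⟩
    rw [LinearMap.sub_apply, LinearMap.id_apply] at hy ⊢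
    rw [← hy, Submodule.coe_sub]
    rfl
  -- hence a coboundary of `A`; project the witness to `W₁`
  obtain ⟨x, hx⟩ := hinj ⟨_, hψmem⟩ hψ
  refine ⟨W₁.projectionOnto W₂ hc x, fun g => ?_⟩
  have e := congrArg (W₁.projectionOnto W₂ hc) (hx g)
  rw [map_sub, localTubeSpan_projectionOnto_apply_rho A W₁ W₂ h₁ h₂ hc] at e
  rw [e]
  exact Submodule.projectionOnto_apply_left hc (φ g)

/-- **Cyclic detection glues over a stable decomposition.**  If `A = W₁ ⊕ W₂` with both
summands `G`-stable and Schnell's third maps of `W₁` and `W₂` are injective, then so is the third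
map of `A`: the projections `pᵢ ∘ φ` of an undetected cocycle `φ` of `A` are undetected cocycles
of `Wᵢ`, so `pᵢ (φ g) = g·xᵢ - xᵢ`, and `φ g = ↑(p₁ (φ g)) + ↑(p₂ (φ g)) = g·(x₁ + x₂) - (x₁ + x₂)`.
[folklore] -/
theorem localTubeSpan_injective_evalCoinv_of_isCompl {k G : Type u} [Group G] [CommRing k]
    (A : Rep k G) (W₁ W₂ : Submodule k A.V)
    (h₁ : ∀ g : G, W₁ ≤ W₁.comap (A.ρ g)) (h₂ : ∀ g : G, W₂ ≤ W₂.comap (A.ρ g))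
    (hc : IsCompl W₁ W₂)
    (hinj₁ : Function.Injective (evalCoinv (Rep.of (A.ρ.subrepresentation W₁ h₁))))
    (hinj₂ : Function.Injective (evalCoinv (Rep.of (A.ρ.subrepresentation W₂ h₂)))) :
    Function.Injective (evalCoinv A) := by
  rw [localTubeSpan_injective_evalCoinv_iff_forall_cocycles₁] at hinj₁ hinj₂ ⊢
  intro φ hφ
  obtain ⟨x₁, hx₁⟩ :=
    hinj₁ ⟨_, localTubeSpan_projectionOnto_comp_mem_cocycles₁ A W₁ W₂ h₁ h₂ hc φ⟩
      (localTubeSpan_projectionOnto_apply_mem_subOneRange A W₁ W₂ h₁ h₂ hc φ hφ)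
  obtain ⟨x₂, hx₂⟩ :=
    hinj₂ ⟨_, localTubeSpan_projectionOnto_comp_mem_cocycles₁ A W₂ W₁ h₂ h₁ hc.symm φ⟩
      (localTubeSpan_projectionOnto_apply_mem_subOneRange A W₂ W₁ h₂ h₁ hc.symm φ hφ)
  refine ⟨(x₁ : A.V) + x₂, fun g => ?_⟩
  -- the two coboundary identities, read in `A`
  have e₁ : A.ρ g (x₁ : A.V) - x₁ = (W₁.projectionOnto W₂ hc (φ g) : A.V) :=
    congrArg Subtype.val (hx₁ g)
  have e₂ : A.ρ g (x₂ : A.V) - x₂ = (W₂.projectionOnto W₁ hc.symm (φ g) : A.V) :=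
    congrArg Subtype.val (hx₂ g)
  calc A.ρ g ((x₁ : A.V) + x₂) - ((x₁ : A.V) + x₂)
      = (A.ρ g (x₁ : A.V) - x₁) + (A.ρ g (x₂ : A.V) - x₂) := by rw [map_add]; abel
    _ = (W₁.projectionOnto W₂ hc (φ g) : A.V) + (W₂.projectionOnto W₁ hc.symm (φ g) : A.V) := by
        rw [e₁, e₂]
    _ = φ g := Submodule.projection_add_projection_eq_self hc _

/-- **Cyclic detection across a stable direct-sum decomposition** (stub `stub_directSum` of the
line).  If `A = W₁ ⊕ W₂` with both summands `G`-stable, Schnell's third map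
`H¹(G, A) → ∏_g A/(g - 1)A` is injective iff those of the subrepresentations `W₁` and `W₂` are
(`H¹(G, W₁ ⊕ W₂) = H¹(G, W₁) ⊕ H¹(G, W₂)` and `(g - 1)(W₁ ⊕ W₂) = (g - 1)W₁ ⊕ (g - 1)W₂`).  In
the route, with `W₂ = i^*H^{2p-1}(X)` (trivial action, detection automatic), this moves between
the full cohomology of the smooth member and its vanishing part. [folklore] -/
theorem localTubeSpan_injective_evalCoinv_iff_of_isCompl {k G : Type u} [Group G] [CommRing k]
    (A : Rep k G) (W₁ W₂ : Submodule k A.V)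
    (h₁ : ∀ g : G, W₁ ≤ W₁.comap (A.ρ g)) (h₂ : ∀ g : G, W₂ ≤ W₂.comap (A.ρ g))
    (hc : IsCompl W₁ W₂) :
    Function.Injective (evalCoinv A) ↔
      Function.Injective (evalCoinv (Rep.of (A.ρ.subrepresentation W₁ h₁))) ∧
        Function.Injective (evalCoinv (Rep.of (A.ρ.subrepresentation W₂ h₂))) :=
  ⟨fun h =>
    ⟨localTubeSpan_injective_evalCoinv_subrepresentation_of_isCompl A W₁ W₂ h₁ h₂ hc h,
      localTubeSpan_injective_evalCoinv_subrepresentation_of_isCompl A W₂ W₁ h₂ h₁ hc.symm h⟩,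
    fun h => localTubeSpan_injective_evalCoinv_of_isCompl A W₁ W₂ h₁ h₂ hc h.1 h.2⟩

end Summit.HodgeConjecture.HodgeConjecture.Theorems

end
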